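import Literature.MathematicalPhysics.KineticTheory.HardSphereEuler
import Literature.Analysis.FunctionSpaces.TorusTrigPoly
import Mathlib.Analysis.Fourier.AddCircleMulti
import HarnessLib

/-!
# `StressStrongMixing` · line `birth`, stub `stub_torusStressIdentificationTrig` (helper 1/3):
# real Fourier monomials on `𝕋³` — addition formulas, Haar integrals for the GLOBAL volume, and the abstract
# Schur/averaging lemma for translation-invariant forms

Support file for the crux item stmt-AtomisticToContinuum-9584 (`StressStrongMixing`, route `MourreKoopmanCharges` of
`AtomisticToContinuum/HydrodynamicLimit`), line `birth` (`Cruxes/StressStrongMixing/Lines/birth.lean`), registered stub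
`stub_torusStressIdentificationTrig` (torus → `ℋ` identification of the two-time stress moments on real Fourier monomials
`χ₁ ∈ {Re e_n, Im e_n}`, `χ₂ ∈ {Re e_m, Im e_m}`, `e_n = UnitAddTorus.mFourier n`).  This first helper is pure harmonic
analysis on the macroscopic torus `𝕋³ = UnitAddTorus (Fin 3)` with H21's GLOBAL `volume` (NOT the local `haarAddCircle`
instance of `Mathlib.Analysis.Fourier.AddCircleMulti`; the bridge is the tree's `Torus.integral_mFourier`):

* `re_mFourier_add`, `im_mFourier_add` — addition formulas `Re e_n(x+a) = Re e_n(a) Re e_n(x) − Im e_n(a) Im e_n(x)`, …;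
* `integral_re_mFourier`, `integral_im_mFourier`, `integral_re_mul_re_mFourier` (&c.) — `∫ Re e_k = δ_{k0}`, `∫ Im e_k = 0`,
  `∫ Re e_n Re e_m = (δ_{n+m,0} + δ_{n,m})/2`, `∫ Re e_n Im e_m = ∫ Im e_n Re e_m = 0`, `∫ Im e_n Im e_m = (δ_{n,m} − δ_{n+m,0})/2`;
* `trigForm_average` — **abstract Schur orthogonality**: a real function `B` of two test functions on `𝕋³` which is invariant
  under simultaneous translation of both arguments and bilinear on the real span of `{Re e_n, Im e_n} × {Re e_m, Im e_m}`
  satisfies, by averaging `B(χ₁, χ₂) = B(χ₁(·+a), χ₂(·+a))` over `a ∈ 𝕋³`,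
  `B_cc = I_cc B_cc + I_ss B_ss`, `B_cs = I_cc B_cs − I_ss B_sc`, `B_sc = I_cc B_sc − I_ss B_cs`, `B_ss = I_ss B_cc + I_cc B_ss`
  (`I_cc = ∫ Re e_n Re e_m`, `I_ss = ∫ Im e_n Im e_m`).  Applied to `B = M_N(s; ·, ·)` (the crux's torus two-time stress
  moment, translation invariant by `torusStressMoment_posShift`) in the next two helpers.

References: L. Grafakos, *Classical Fourier Analysis* (2014), §3.1.1 (characters of `𝕋ᵈ`); H. Spohn, *Large Scale Dynamics
of Interacting Particles* (1991), Part I §7.1.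
-/

noncomputable section

open MeasureTheory ProbabilityTheory Filter Topology
open scoped InnerProductSpace ENNReal

namespace Summit.AtomisticToContinuum.HydrodynamicLimit.Theorems.MourreKoopmanChargesStressStrongMixing

open Literature.MathematicalPhysics.KineticTheory Literature.Analysis.FluidPDE

/-! ### Real Fourier monomials on `𝕋³`: addition formulas and Haar integrals for the GLOBAL volume -/

section Trig

open UnitAddTorus

/-- The characters of `𝕋³` are multiplicative: `e_n(x + a) = e_n(x) e_n(a)`. [folklore] -/
theorem mFourier_apply_add_T3 (n : Fin 3 → ℤ) (x a : T3) :
    mFourier n (x + a) = mFourier n x * mFourier n a := by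
  simp only [mFourier, ContinuousMap.coe_mk, Pi.add_apply, fourier_apply, zsmul_add, AddCircle.toCircle_add,
    Circle.coe_mul, Finset.prod_mul_distrib]

/-- Addition formula for the real Fourier monomial `Re e_n`: `Re e_n(x+a) = Re e_n(a) Re e_n(x) − Im e_n(a) Im e_n(x)`.
[folklore] -/
theorem re_mFourier_add (n : Fin 3 → ℤ) (x a : T3) :
    (mFourier n (x + a)).re = (mFourier n a).re * (mFourier n x).re + -(mFourier n a).im * (mFourier n x).im := by
  rw [mFourier_apply_add_T3, Complex.mul_re]
  ring

/-- Addition formula for the real Fourier monomial `Im e_n`: `Im e_n(x+a) = Im e_n(a) Re e_n(x) + Re e_n(a) Im e_n(x)`.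
[folklore] -/
theorem im_mFourier_add (n : Fin 3 → ℤ) (x a : T3) :
    (mFourier n (x + a)).im = (mFourier n a).im * (mFourier n x).re + (mFourier n a).re * (mFourier n x).im := by
  rw [mFourier_apply_add_T3, Complex.mul_im]
  ring

/-- `Re e_n` is continuous. [folklore] -/
theorem continuous_re_mFourier (n : Fin 3 → ℤ) : Continuous fun x : T3 => (mFourier n x).re :=
  Complex.continuous_re.comp (mFourier n).continuous

/-- `Im e_n` is continuous. [folklore] -/
theorem continuous_im_mFourier (n : Fin 3 → ℤ) : Continuous fun x : T3 => (mFourier n x).im :=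
  Complex.continuous_im.comp (mFourier n).continuous

/-- `∫_{𝕋³} Re e_k = δ_{k0}` (global volume). [folklore] -/
theorem integral_re_mFourier (k : Fin 3 → ℤ) :
    ∫ x : T3, (mFourier k x).re = if k = 0 then 1 else 0 := by
  have hint : Integrable (fun x : T3 => mFourier k x) volume := (mFourier k).continuous.integrable_unitAddTorus
  have h := Complex.reCLM.integral_comp_comm hint
  simp only [Complex.reCLM_apply] at h
  rw [h, Literature.Analysis.FunctionSpaces.Torus.integral_mFourier]
  split_ifs <;> simp

/-- `∫_{𝕋³} Im e_k = 0` (global volume). [folklore] -/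
theorem integral_im_mFourier (k : Fin 3 → ℤ) : ∫ x : T3, (mFourier k x).im = 0 := by
  have hint : Integrable (fun x : T3 => mFourier k x) volume := (mFourier k).continuous.integrable_unitAddTorus
  have h := Complex.imCLM.integral_comp_comm hint
  simp only [Complex.imCLM_apply] at h
  rw [h, Literature.Analysis.FunctionSpaces.Torus.integral_mFourier]
  split_ifs <;> simp

/-- Product-to-sum: `Re e_n · Re e_m = (Re e_{n+m} + Re e_{n-m})/2`. [folklore] -/
theorem re_mul_re_mFourier (n m : Fin 3 → ℤ) (x : T3) :
    (mFourier n x).re * (mFourier m x).re = ((mFourier (n + m) x).re + (mFourier (n - m) x).re) / 2 := by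
  rw [sub_eq_add_neg, mFourier_add, mFourier_add, mFourier_neg]
  simp only [Complex.mul_re, Complex.conj_re, Complex.conj_im]
  ring

/-- Product-to-sum: `Re e_n · Im e_m = (Im e_{n+m} - Im e_{n-m})/2`. [folklore] -/
theorem re_mul_im_mFourier (n m : Fin 3 → ℤ) (x : T3) :
    (mFourier n x).re * (mFourier m x).im = ((mFourier (n + m) x).im - (mFourier (n - m) x).im) / 2 := by
  rw [sub_eq_add_neg n m, mFourier_add, mFourier_add, mFourier_neg]
  simp only [Complex.mul_im, Complex.conj_re, Complex.conj_im]
  ring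

/-- Product-to-sum: `Im e_n · Re e_m = (Im e_{n+m} + Im e_{n-m})/2`. [folklore] -/
theorem im_mul_re_mFourier (n m : Fin 3 → ℤ) (x : T3) :
    (mFourier n x).im * (mFourier m x).re = ((mFourier (n + m) x).im + (mFourier (n - m) x).im) / 2 := by
  rw [sub_eq_add_neg, mFourier_add, mFourier_add, mFourier_neg]
  simp only [Complex.mul_im, Complex.conj_re, Complex.conj_im]
  ring

/-- Product-to-sum: `Im e_n · Im e_m = (Re e_{n-m} - Re e_{n+m})/2`. [folklore] -/
theorem im_mul_im_mFourier (n m : Fin 3 → ℤ) (x : T3) :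
    (mFourier n x).im * (mFourier m x).im = ((mFourier (n - m) x).re - (mFourier (n + m) x).re) / 2 := by
  rw [sub_eq_add_neg n m, mFourier_add, mFourier_add, mFourier_neg]
  simp only [Complex.mul_re, Complex.conj_re, Complex.conj_im]
  ring

/-- `∫ Re e_n Re e_m = (δ_{n+m,0} + δ_{n,m})/2` (global volume). [folklore] -/
theorem integral_re_mul_re_mFourier :
    ∀ n m : Fin 3 → ℤ, ∫ x : T3, (UnitAddTorus.mFourier n x).re * (UnitAddTorus.mFourier m x).re =
      ((if n + m = 0 then (1 : ℝ) else 0) + (if n - m = 0 then (1 : ℝ) else 0)) / 2 := by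
  intro n m
  simp_rw [re_mul_re_mFourier]
  rw [integral_div, integral_add (continuous_re_mFourier _).integrable_unitAddTorus
    (continuous_re_mFourier _).integrable_unitAddTorus, integral_re_mFourier, integral_re_mFourier]

/-- `∫ Re e_n Im e_m = 0` (global volume). [folklore] -/
theorem integral_re_mul_im_mFourier (n m : Fin 3 → ℤ) :
    ∫ x : T3, (mFourier n x).re * (mFourier m x).im = 0 := by
  simp_rw [re_mul_im_mFourier]
  rw [integral_div, integral_sub (continuous_im_mFourier _).integrable_unitAddTorus
    (continuous_im_mFourier _).integrable_unitAddTorus, integral_im_mFourier, integral_im_mFourier]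
  simp

/-- `∫ Im e_n Re e_m = 0` (global volume). [folklore] -/
theorem integral_im_mul_re_mFourier (n m : Fin 3 → ℤ) :
    ∫ x : T3, (mFourier n x).im * (mFourier m x).re = 0 := by
  simp_rw [im_mul_re_mFourier]
  rw [integral_div, integral_add (continuous_im_mFourier _).integrable_unitAddTorus
    (continuous_im_mFourier _).integrable_unitAddTorus, integral_im_mFourier, integral_im_mFourier]
  simp

/-- `∫ Im e_n Im e_m = (δ_{n,m} - δ_{n+m,0})/2` (global volume). [folklore] -/
theorem integral_im_mul_im_mFourier (n m : Fin 3 → ℤ) :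
    ∫ x : T3, (mFourier n x).im * (mFourier m x).im =
      ((if n - m = 0 then 1 else 0) - (if n + m = 0 then 1 else 0)) / 2 := by
  simp_rw [im_mul_im_mFourier]
  rw [integral_div, integral_sub (continuous_re_mFourier _).integrable_unitAddTorus
    (continuous_re_mFourier _).integrable_unitAddTorus, integral_re_mFourier, integral_re_mFourier]

/-- Linear combinations of four integrable functions integrate termwise. [folklore] -/
theorem integral_lin4 {f₁ f₂ f₃ f₄ : T3 → ℝ} (h₁ : Integrable f₁) (h₂ : Integrable f₂) (h₃ : Integrable f₃)
    (h₄ : Integrable f₄) (A B C D : ℝ) :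
    ∫ a, (A * f₁ a + B * f₂ a + C * f₃ a + D * f₄ a) =
      A * (∫ a, f₁ a) + B * (∫ a, f₂ a) + C * (∫ a, f₃ a) + D * (∫ a, f₄ a) := by
  have i1 : Integrable (fun a => A * f₁ a) := h₁.const_mul A
  have i2 : Integrable (fun a => B * f₂ a) := h₂.const_mul B
  have i3 : Integrable (fun a => C * f₃ a) := h₃.const_mul C
  have i4 : Integrable (fun a => D * f₄ a) := h₄.const_mul D
  have i12 : Integrable (fun a => A * f₁ a + B * f₂ a) := i1.add i2
  have i123 : Integrable (fun a => A * f₁ a + B * f₂ a + C * f₃ a) := i12.add i3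
  rw [integral_add i123 i4, integral_add i12 i3, integral_add i1 i2, integral_const_mul, integral_const_mul,
    integral_const_mul, integral_const_mul]

/-- A constant equal to a function everywhere is its Haar average (`𝕋³` has volume one). [folklore] -/
theorem eq_integral_of_forall_eq {b : ℝ} {g : T3 → ℝ} (h : ∀ a, b = g a) : b = ∫ a, g a := by
  have hg : g = fun _ => b := funext fun a => (h a).symm
  rw [hg, integral_const, probReal_univ, one_smul]

/-- **Schur orthogonality for translation-invariant forms on real Fourier monomials** (abstract averaging lemma).
Let `B` be any real function of two test functions on `𝕋³` which is invariant under simultaneous translation of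
both arguments and bilinear on the real spans of `{Re e_n, Im e_n} × {Re e_m, Im e_m}`.  Averaging the identity
`B(χ₁, χ₂) = B(χ₁(·+a), χ₂(·+a))` over `a ∈ 𝕋³` with the addition formulas gives the four relations
`B_cc = I_cc B_cc + I_ss B_ss`, `B_cs = I_cc B_cs − I_ss B_sc`, `B_sc = I_cc B_sc − I_ss B_cs`, `B_ss = I_ss B_cc + I_cc B_ss`
with `I_cc = ∫ Re e_n Re e_m`, `I_ss = ∫ Im e_n Im e_m` (the mixed integrals `∫ Re e_n Im e_m`, `∫ Im e_n Re e_m` vanish).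
[folklore] -/
theorem trigForm_average {B : (T3 → ℝ) → (T3 → ℝ) → ℝ} (n m : Fin 3 → ℤ)
    (hT : ∀ (a : T3) (χ₁ χ₂ : T3 → ℝ), B (fun x => χ₁ (x + a)) (fun x => χ₂ (x + a)) = B χ₁ χ₂)
    (hB : ∀ α β γ δ : ℝ,
      B (fun x => α * (mFourier n x).re + β * (mFourier n x).im)
          (fun x => γ * (mFourier m x).re + δ * (mFourier m x).im) =
        α * γ * B (fun x => (mFourier n x).re) (fun x => (mFourier m x).re) +
        α * δ * B (fun x => (mFourier n x).re) (fun x => (mFourier m x).im) +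
        β * γ * B (fun x => (mFourier n x).im) (fun x => (mFourier m x).re) +
        β * δ * B (fun x => (mFourier n x).im) (fun x => (mFourier m x).im)) :
    (B (fun x => (mFourier n x).re) (fun x => (mFourier m x).re) =
        (∫ a : T3, (mFourier n a).re * (mFourier m a).re) * B (fun x => (mFourier n x).re) (fun x => (mFourier m x).re) +
        (∫ a : T3, (mFourier n a).im * (mFourier m a).im) * B (fun x => (mFourier n x).im) (fun x => (mFourier m x).im)) ∧
    (B (fun x => (mFourier n x).re) (fun x => (mFourier m x).im) =
        (∫ a : T3, (mFourier n a).re * (mFourier m a).re) * B (fun x => (mFourier n x).re) (fun x => (mFourier m x).im) -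
        (∫ a : T3, (mFourier n a).im * (mFourier m a).im) * B (fun x => (mFourier n x).im) (fun x => (mFourier m x).re)) ∧
    (B (fun x => (mFourier n x).im) (fun x => (mFourier m x).re) =
        (∫ a : T3, (mFourier n a).re * (mFourier m a).re) * B (fun x => (mFourier n x).im) (fun x => (mFourier m x).re) -
        (∫ a : T3, (mFourier n a).im * (mFourier m a).im) * B (fun x => (mFourier n x).re) (fun x => (mFourier m x).im)) ∧
    (B (fun x => (mFourier n x).im) (fun x => (mFourier m x).im) =
        (∫ a : T3, (mFourier n a).im * (mFourier m a).im) * B (fun x => (mFourier n x).re) (fun x => (mFourier m x).re) +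
        (∫ a : T3, (mFourier n a).re * (mFourier m a).re) * B (fun x => (mFourier n x).im) (fun x => (mFourier m x).im)) := by
  -- the translated monomials as linear combinations of the monomials
  have hTc : ∀ (k : Fin 3 → ℤ) (a : T3), (fun x : T3 => (mFourier k (x + a)).re) =
      fun x => (mFourier k a).re * (mFourier k x).re + -(mFourier k a).im * (mFourier k x).im :=
    fun k a => funext fun x => re_mFourier_add k x a
  have hTs : ∀ (k : Fin 3 → ℤ) (a : T3), (fun x : T3 => (mFourier k (x + a)).im) =
      fun x => (mFourier k a).im * (mFourier k x).re + (mFourier k a).re * (mFourier k x).im :=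
    fun k a => funext fun x => im_mFourier_add k x a
  -- integrability of the coefficient products and the two vanishing Haar integrals
  have hi : ∀ (f g : T3 → ℝ), Continuous f → Continuous g → Integrable (fun a => f a * g a) (volume : Measure T3) :=
    fun f g hf hg => (hf.mul hg).integrable_unitAddTorus
  have icc := hi _ _ (continuous_re_mFourier n) (continuous_re_mFourier m)
  have ics := hi _ _ (continuous_re_mFourier n) (continuous_im_mFourier m)
  have isc := hi _ _ (continuous_im_mFourier n) (continuous_re_mFourier m)
  have iss := hi _ _ (continuous_im_mFourier n) (continuous_im_mFourier m)
  have Ics := integral_re_mul_im_mFourier n m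
  have Isc := integral_im_mul_re_mFourier n m
  -- the four translated identities, pointwise in `a`
  have kcc : ∀ a : T3, B (fun x => (mFourier n x).re) (fun x => (mFourier m x).re) =
      B (fun x => (mFourier n x).re) (fun x => (mFourier m x).re) * ((mFourier n a).re * (mFourier m a).re) +
      (-B (fun x => (mFourier n x).re) (fun x => (mFourier m x).im)) * ((mFourier n a).re * (mFourier m a).im) +
      (-B (fun x => (mFourier n x).im) (fun x => (mFourier m x).re)) * ((mFourier n a).im * (mFourier m a).re) +
      B (fun x => (mFourier n x).im) (fun x => (mFourier m x).im) * ((mFourier n a).im * (mFourier m a).im) := by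
    intro a
    have h1 := hT a (fun x => (mFourier n x).re) (fun x => (mFourier m x).re)
    rw [hTc n a, hTc m a, hB] at h1
    linear_combination (-1 : ℝ) * h1
  have kcs : ∀ a : T3, B (fun x => (mFourier n x).re) (fun x => (mFourier m x).im) =
      B (fun x => (mFourier n x).re) (fun x => (mFourier m x).im) * ((mFourier n a).re * (mFourier m a).re) +
      B (fun x => (mFourier n x).re) (fun x => (mFourier m x).re) * ((mFourier n a).re * (mFourier m a).im) +
      (-B (fun x => (mFourier n x).im) (fun x => (mFourier m x).im)) * ((mFourier n a).im * (mFourier m a).re) +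
      (-B (fun x => (mFourier n x).im) (fun x => (mFourier m x).re)) * ((mFourier n a).im * (mFourier m a).im) := by
    intro a
    have h1 := hT a (fun x => (mFourier n x).re) (fun x => (mFourier m x).im)
    rw [hTc n a, hTs m a, hB] at h1
    linear_combination (-1 : ℝ) * h1
  have ksc : ∀ a : T3, B (fun x => (mFourier n x).im) (fun x => (mFourier m x).re) =
      B (fun x => (mFourier n x).im) (fun x => (mFourier m x).re) * ((mFourier n a).re * (mFourier m a).re) +
      (-B (fun x => (mFourier n x).im) (fun x => (mFourier m x).im)) * ((mFourier n a).re * (mFourier m a).im) +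
      B (fun x => (mFourier n x).re) (fun x => (mFourier m x).re) * ((mFourier n a).im * (mFourier m a).re) +
      (-B (fun x => (mFourier n x).re) (fun x => (mFourier m x).im)) * ((mFourier n a).im * (mFourier m a).im) := by
    intro a
    have h1 := hT a (fun x => (mFourier n x).im) (fun x => (mFourier m x).re)
    rw [hTs n a, hTc m a, hB] at h1
    linear_combination (-1 : ℝ) * h1
  have kss : ∀ a : T3, B (fun x => (mFourier n x).im) (fun x => (mFourier m x).im) =
      B (fun x => (mFourier n x).im) (fun x => (mFourier m x).im) * ((mFourier n a).re * (mFourier m a).re) +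
      B (fun x => (mFourier n x).im) (fun x => (mFourier m x).re) * ((mFourier n a).re * (mFourier m a).im) +
      B (fun x => (mFourier n x).re) (fun x => (mFourier m x).im) * ((mFourier n a).im * (mFourier m a).re) +
      B (fun x => (mFourier n x).re) (fun x => (mFourier m x).re) * ((mFourier n a).im * (mFourier m a).im) := by
    intro a
    have h1 := hT a (fun x => (mFourier n x).im) (fun x => (mFourier m x).im)
    rw [hTs n a, hTs m a, hB] at h1
    linear_combination (-1 : ℝ) * h1
  refine ⟨?_, ?_, ?_, ?_⟩
  · have e := eq_integral_of_forall_eq kcc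
    rw [integral_lin4 icc ics isc iss, Ics, Isc] at e
    linear_combination e
  · have e := eq_integral_of_forall_eq kcs
    rw [integral_lin4 icc ics isc iss, Ics, Isc] at e
    linear_combination e
  · have e := eq_integral_of_forall_eq ksc
    rw [integral_lin4 icc ics isc iss, Ics, Isc] at e
    linear_combination e
  · have e := eq_integral_of_forall_eq kss
    rw [integral_lin4 icc ics isc iss, Ics, Isc] at e
    linear_combination e

end Trig

end Summit.AtomisticToContinuum.HydrodynamicLimit.Theorems.MourreKoopmanChargesStressStrongMixing

end
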